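import Literature.Analysis.FluidPDE.ForcedClassicalRestart
import HarnessLib

/-!
# The blow-up alternative for classical solutions of the FORCED Navier–Stokes system on `ℝ³`
# (Clay-class force): a global solution in the class `L^∞_t H^k_x`, or a finite maximal time at
# which the `H¹` norm blows up

Analysis/FluidPDE **proofs file** (theorems only: no definitions, no named facts). The forced twin of
the tree's unforced alternatives `finiteEnergy_classical_dichotomy` (`ClassicalNSBlowupAlternative`)
and `bkmClass_dichotomy` (`NSVorticityBKMMaximal`), for `ν > 0` and a force `f` smooth on the closed
half-space `[0,∞) × ℝ³` with Fefferman's space–time decay (`IsSmoothOnHalfSpace f`,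
`HasRapidSpaceTimeDecay f`; e.g. every `C^∞` compactly supported space–time force,
`clayForce_of_hasCompactSupport`). The class is Tao's `L^∞_t H^k_x` for every `k`
(`HasBoundedSobolevNormsOn`). The restart step is `ForcedClassicalRestart.lean`.

* `forced_sobolevClass_dichotomy` — **THE ALTERNATIVE**: for a smooth divergence-free `H^∞` datum,
  EITHER every closed slab `[0, T]`, `T > 0`, carries a classical solution of the forced system from
  `u₀` with all `L²` Sobolev norms bounded on `[0, T]`, OR there are `T* > 0` and a classical solution
  on `[0, T*) × ℝ³` from `u₀`, in the class on every `[0, T'']`, `T'' < T*`, whose `H¹` size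
  `∫|u(t)|² + ∫|∇u(t)|²_F` — hence its squared `H³` size `Σ_{n ≤ 3} ∫‖Dⁿu(t)‖²` — is UNBOUNDED on
  `[0, T*)`, and past which no closed slab carries a class solution from `u₀` (Lemarié-Rieusset 2016,
  Thm. 7.2: `T_MAX < ∞ ⇒ sup_{t<T_MAX} ‖u(t)‖_{H¹} = ∞`). Word for word the proof of
  `finiteEnergy_classical_dichotomy`: the set of good horizons is a nonempty
  (`exists_forced_sobolevClass_Icc_of_sobolevDatum`) initial segment of `(0, ∞)`, OPEN TO THE RIGHT
  (`exists_forced_sobolevClass_Icc_extension`), so its supremum `T*` is not a member when finite; the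
  class solutions on `[0, T*(n+1)/(n+2)]` agree at common times
  (`IsClassicalNSSolutionOn.velocity_eq_of_hasBoundedSobolevNormsOn`, valid with force) and glue to
  `[0, T*)` (`IsClassicalNSSolutionOn.exists_glue_Ico_right`); an `H¹` bound up to `T*` would restart
  it past `T*` (`exists_forced_Icc_extension_of_H1_bound`).
* `exists_global_forced_sobolevClass_or_blowup` — the GLOBAL form (first branch patched to
  `[0, ∞)` by `IsClassicalNSSolutionOn.exists_Ici_of_forall_Icc_of_unique`, pressure `p(t, 0) = 0`).

Consumers: forced claim skeletons of the D-0090 claims map (e.g.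
`Literature.Claims.NS.Fathi2025.Step23_local`, discharged Summits-side). Tree search: forced
CONTINUATION criteria (`lemarieRieusset2016_H1_continuation_forced_holds`, `NSForcedEnstrophyOfSupNorm`)
and forced EXISTENCE on a prescribed slab under smallness (`smooth_existence_forced_fullSlab`) exist, as
do the UNFORCED maximal-solution alternatives; no forced maximal-solution / dichotomy theorem
(`rg 'sSup {T'`, `'dichotomy'`, `'or_blowup'` over `Literature/Analysis/FluidPDE`).

## References

* P. G. Lemarié-Rieusset, *The Navier–Stokes Problem in the 21st Century*, CRC Press 2016, Thm. 7.2
  and its proof, Thm. 7.3. [LemarieRieusset2016]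
* T. Tao, Anal. PDE 6 (2013) = arXiv:1108.1165, Thm. 5.4 (ii)+(iv) (arXiv Thm. 31) with force,
  Cor. 11.1. [Tao2011]
* J. T. Beale, T. Kato, A. Majda, Comm. Math. Phys. 94 (1984), §1 (maximal interval). [BealeKatoMajda1984]
* J. C. Robinson, J. L. Rodrigo, W. Sadowski, CUP 2016, Thm. 8.17, §8.1. [RobinsonRodrigoSadowski2016]

WHAT THIS IS NOT: not a claim about NS regularity or blow-up; not a claim about any author beyond the
typed locator.
-/

noncomputable section

open MeasureTheory Set Function Filter Topology
open scoped ENNReal NNReal ContDiff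

namespace Literature.Analysis.FluidPDE

variable {ν : ℝ} {f : ℝ → EuclideanSpace ℝ (Fin 3) → EuclideanSpace ℝ (Fin 3)}
  {u₀ : EuclideanSpace ℝ (Fin 3) → EuclideanSpace ℝ (Fin 3)}

/-! ## Plumbing -/

/-- The `H¹` size is at most four times the squared `H³` size `Σ_{n ≤ 3} ∫‖Dⁿu‖²`; so a bound on the
latter along `[0, T)` bounds the former. [folklore] -/
private theorem exists_H1_bound_of_H3_bound {T : ℝ}
    {u : ℝ → EuclideanSpace ℝ (Fin 3) → EuclideanSpace ℝ (Fin 3)}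
    (h : ∃ A : ℝ≥0, ∀ t ∈ Ico 0 T,
      (∑ n ∈ Finset.range 4, ∫⁻ x, ‖iteratedFDeriv ℝ n (u t) x‖ₑ ^ 2) ≤ (A : ℝ≥0∞)) :
    ∃ A : ℝ≥0, ∀ t ∈ Ico 0 T, (∫⁻ x, ‖u t x‖ₑ ^ 2) +
      (∫⁻ x, ENNReal.ofReal (frobeniusNormSq (fderiv ℝ (u t) x))) ≤ A := by
  obtain ⟨A, hA⟩ := h
  refine ⟨A + 3 * A, fun t ht => ?_⟩
  have h0 : ∫⁻ x, ‖iteratedFDeriv ℝ 0 (u t) x‖ₑ ^ 2 ≤ A :=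
    (Finset.single_le_sum (f := fun n => ∫⁻ x, ‖iteratedFDeriv ℝ n (u t) x‖ₑ ^ 2)
      (fun _ _ => bot_le) (Finset.mem_range.2 (by norm_num))).trans (hA t ht)
  have h1 : ∫⁻ x, ‖iteratedFDeriv ℝ 1 (u t) x‖ₑ ^ 2 ≤ A :=
    (Finset.single_le_sum (f := fun n => ∫⁻ x, ‖iteratedFDeriv ℝ n (u t) x‖ₑ ^ 2)
      (fun _ _ => bot_le) (Finset.mem_range.2 (by norm_num))).trans (hA t ht)
  push_cast
  refine add_le_add ?_ ?_
  · rw [lintegral_enorm_sq_eq_lintegral_iteratedFDeriv_zero]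
    exact h0
  · exact (lintegral_frobeniusNormSq_le_three_mul (u t)).trans (by gcongr)

/-! ## The alternative -/

/-- **The blow-up alternative for classical solutions of the FORCED Navier–Stokes system on `ℝ³`
(Clay-class force, class `L^∞_t H^k_x`).** Let `ν > 0`, let `f` be smooth on `[0,∞) × ℝ³` with
Fefferman's space–time decay, and let `u₀` be smooth, divergence free, with all derivatives in `L²`.
Then EITHER every closed slab `[0, T] × ℝ³`, `T > 0`, carries a classical solution of the system with
force `f` from `u₀` with all `L²` Sobolev norms bounded on `[0, T]`, OR there are `T* > 0` and a
classical solution `(u, p)` with force `f` on `[0, T*) × ℝ³` from `u₀`, in the class on every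
`[0, T'']`, `T'' < T*`, whose `H¹` size `∫|u(t)|² + ∫|∇u(t)|²_F` and whose squared `H³` size
`Σ_{n ≤ 3} ∫‖Dⁿu(t)‖²` are UNBOUNDED on `[0, T*)`, and such that no closed slab `[0, T]`, `T ≥ T*`,
carries a classical solution from `u₀` in the class (`T*` is the maximal time of existence in the
class; Lemarié-Rieusset 2016, Thm. 7.2: `T_MAX < ∞ ⇒ sup_{t<T_MAX} ‖u(t)‖_{H¹} = ∞`). See the module
docstring for the proof from the tree's forced local existence, uniqueness, gluing and restart
theorems. [cite: LemarieRieusset2016, Thm. 7.2 (p. 125) with Thm. 7.3] [cite: Tao2011, Thm. 5.4 (ii)+(iv), Cor. 11.1] [cite: BealeKatoMajda1984, §1] -/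
theorem forced_sobolevClass_dichotomy (hν : 0 < ν) (hfs : IsSmoothOnHalfSpace f)
    (hfd : HasRapidSpaceTimeDecay f) (hu₀ : ContDiff ℝ ∞ u₀) (hdiv : VectorCalculus.IsDivFree u₀)
    (hH : ∀ n : ℕ, ∫⁻ x, ‖iteratedFDeriv ℝ n u₀ x‖ₑ ^ 2 < ⊤) :
    (∀ T : ℝ, 0 < T →
      ∃ (u : ℝ → EuclideanSpace ℝ (Fin 3) → EuclideanSpace ℝ (Fin 3))
        (p : ℝ → EuclideanSpace ℝ (Fin 3) → ℝ),
        IsClassicalNSSolutionOn (Icc 0 T) ν f u p ∧ u 0 = u₀ ∧ HasBoundedSobolevNormsOn (Icc 0 T) u) ∨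
    ∃ Ts : ℝ, 0 < Ts ∧
      ∃ (u : ℝ → EuclideanSpace ℝ (Fin 3) → EuclideanSpace ℝ (Fin 3))
        (p : ℝ → EuclideanSpace ℝ (Fin 3) → ℝ),
        IsClassicalNSSolutionOn (Ico 0 Ts) ν f u p ∧ u 0 = u₀ ∧
        (∀ T'' < Ts, HasBoundedSobolevNormsOn (Icc 0 T'') u) ∧
        (¬ ∃ A : ℝ≥0, ∀ t ∈ Ico 0 Ts, (∫⁻ x, ‖u t x‖ₑ ^ 2) +
          (∫⁻ x, ENNReal.ofReal (frobeniusNormSq (fderiv ℝ (u t) x))) ≤ A) ∧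
        (¬ ∃ A : ℝ≥0, ∀ t ∈ Ico 0 Ts,
          (∑ n ∈ Finset.range 4, ∫⁻ x, ‖iteratedFDeriv ℝ n (u t) x‖ₑ ^ 2) ≤ (A : ℝ≥0∞)) ∧
        ∀ T : ℝ, Ts ≤ T →
          ∀ (w : ℝ → EuclideanSpace ℝ (Fin 3) → EuclideanSpace ℝ (Fin 3))
            (q : ℝ → EuclideanSpace ℝ (Fin 3) → ℝ),
            IsClassicalNSSolutionOn (Icc 0 T) ν f w q → w 0 = u₀ →
              ¬ HasBoundedSobolevNormsOn (Icc 0 T) w := by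
  classical
  by_cases hall : ∀ T : ℝ, 0 < T →
      ∃ (u : ℝ → EuclideanSpace ℝ (Fin 3) → EuclideanSpace ℝ (Fin 3))
        (p : ℝ → EuclideanSpace ℝ (Fin 3) → ℝ),
        IsClassicalNSSolutionOn (Icc 0 T) ν f u p ∧ u 0 = u₀ ∧ HasBoundedSobolevNormsOn (Icc 0 T) u
  · exact Or.inl hall
  right
  push Not at hall
  obtain ⟨T₁, hT₁, hnot₁⟩ := hall
  -- the set of good horizons
  set S : Set ℝ := {T | 0 < T ∧
      ∃ (u : ℝ → EuclideanSpace ℝ (Fin 3) → EuclideanSpace ℝ (Fin 3))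
        (p : ℝ → EuclideanSpace ℝ (Fin 3) → ℝ),
        IsClassicalNSSolutionOn (Icc 0 T) ν f u p ∧ u 0 = u₀ ∧ HasBoundedSobolevNormsOn (Icc 0 T) u}
    with hSdef
  -- restriction: `S` is an initial segment of `(0, ∞)`
  have hmono : ∀ {T T' : ℝ}, 0 < T' → T' ≤ T → T ∈ S → T' ∈ S := by
    rintro T T' hT' hle ⟨-, u, p, hcl, h0, hBu⟩
    exact ⟨hT', u, p, hcl.mono (Icc_subset_Icc_right hle) (uniqueDiffOn_Icc hT'), h0,
      hBu.mono (Icc_subset_Icc_right hle)⟩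
  have hT₁S : T₁ ∉ S := fun h => by
    obtain ⟨-, u, p, hcl, h0, hBu⟩ := h
    exact hnot₁ u p hcl h0 hBu
  have hbdd : BddAbove S := ⟨T₁, fun T hT => le_of_not_gt fun h => hT₁S (hmono hT₁ h.le hT)⟩
  -- local existence: `S` is nonempty
  obtain ⟨T₀, hT₀, u₀', p₀', hcl₀, hu₀0, hB₀⟩ :=
    exists_forced_sobolevClass_Icc_of_sobolevDatum hν hfs hfd hu₀ hdiv hH
  have hT₀S : T₀ ∈ S := ⟨hT₀, u₀', p₀', hcl₀, hu₀0, hB₀⟩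
  have hne : S.Nonempty := ⟨T₀, hT₀S⟩
  -- restart: `S` is open to the right
  have hopen : ∀ T ∈ S, ∃ T' ∈ S, T < T' := by
    rintro T ⟨hT, u, p, hcl, h0, hBu⟩
    obtain ⟨T', hTT', u', p', hcl', hB', h0', -⟩ :=
      exists_forced_sobolevClass_Icc_extension hν hT hfs hfd hcl hBu
    exact ⟨T', ⟨hT.trans hTT', u', p', hcl', h0'.trans h0, hB'⟩, hTT'⟩
  -- the maximal time
  set Ts : ℝ := sSup S with hTsdef
  have hT₀le : T₀ ≤ Ts := le_csSup hbdd hT₀S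
  have hTs : 0 < Ts := hT₀.trans_le hT₀le
  have hbelow : ∀ T', 0 < T' → T' < Ts → T' ∈ S := by
    intro T' hT' hlt
    obtain ⟨T, hT, hT'T⟩ := exists_lt_of_lt_csSup hne hlt
    exact hmono hT' hT'T.le hT
  have habove : ∀ T, Ts ≤ T → T ∉ S := by
    intro T hT hTS
    obtain ⟨T', hT'S, hTT'⟩ := hopen T hTS
    exact (le_csSup hbdd hT'S).not_gt (hT.trans_lt hTT')
  -- the horizons `b n = T* (n+1)/(n+2) ↑ T*` and class solutions on their closed slabs
  set b : ℕ → ℝ := fun n => Ts * ((n : ℝ) + 1) / ((n : ℝ) + 2) with hbdef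
  have hbpos : ∀ n, 0 < b n := fun n => by rw [hbdef]; positivity
  have hblt : ∀ n, b n < Ts := fun n => by
    have h2 : (0 : ℝ) < (n : ℝ) + 2 := by positivity
    rw [hbdef, div_lt_iff₀ h2]
    nlinarith
  have hbS : ∀ n, b n ∈ S := fun n => hbelow (b n) (hbpos n) (hblt n)
  choose _hbpos' V P hV hV0 hVB using hbS
  have hb : ∀ t, t < Ts → ∃ n : ℕ, t < b n := by
    intro t ht
    have hpos : 0 < Ts - t := sub_pos.2 ht
    obtain ⟨n, hn⟩ := exists_nat_gt (Ts / (Ts - t))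
    refine ⟨n, ?_⟩
    have h1 : Ts < (n : ℝ) * (Ts - t) := (div_lt_iff₀ hpos).1 hn
    have h2 : (0 : ℝ) < (n : ℝ) + 2 := by positivity
    rw [hbdef, lt_div_iff₀ h2]
    nlinarith [hTs, (Nat.cast_nonneg n : (0 : ℝ) ≤ n)]
  -- any two of the chosen solutions agree at common times (uniqueness in the class, with force)
  have hagree : ∀ m n, ∀ t ∈ Ico (0 : ℝ) (min (b m) (b n)), V m t = V n t := by
    intro m n t ht
    set M : ℝ := min (b m) (b n) with hM
    have hM0 : 0 < M := lt_min (hbpos m) (hbpos n)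
    have hm' : IsClassicalNSSolutionOn (Icc 0 M) ν f (V m) (P m) :=
      (hV m).mono (Icc_subset_Icc_right (min_le_left _ _)) (uniqueDiffOn_Icc hM0)
    have hn' : IsClassicalNSSolutionOn (Icc 0 M) ν f (V n) (P n) :=
      (hV n).mono (Icc_subset_Icc_right (min_le_right _ _)) (uniqueDiffOn_Icc hM0)
    exact hm'.velocity_eq_of_hasBoundedSobolevNormsOn hn' hν.le hM0
      ((hVB m).mono (Icc_subset_Icc_right (min_le_left _ _)))
      ((hVB n).mono (Icc_subset_Icc_right (min_le_right _ _)))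
      ((hV0 m).trans (hV0 n).symm) t ⟨ht.1, ht.2.le⟩
  -- glue them on `[0, T*)`
  have hVIco : ∀ n, IsClassicalNSSolutionOn (Ico 0 (b n)) ν f (V n) (P n) := fun n =>
    (hV n).mono Ico_subset_Icc_self (uniqueDiffOn_Ico 0 (b n))
  obtain ⟨v, q, hv, hvn⟩ := IsClassicalNSSolutionOn.exists_glue_Ico_right (a := 0) (β := Ts)
    (fun n => (hblt n).le) hb hVIco hagree
  have hv0 : v 0 = u₀ := (hvn 0 0 ⟨le_rfl, hbpos 0⟩).trans (hV0 0)
  -- the class bounds of `v` on compact sub-slabs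
  have hvB : ∀ T'' < Ts, HasBoundedSobolevNormsOn (Icc 0 T'') v := by
    intro T'' hT''
    obtain ⟨n, hn⟩ := hb T'' hT''
    intro k
    obtain ⟨C, hC⟩ := hVB n k
    refine ⟨C, fun t ht => ?_⟩
    rw [hvn n t ⟨ht.1, ht.2.trans_lt hn⟩]
    exact hC t ⟨ht.1, (ht.2.trans_lt hn).le⟩
  -- `H¹` BLOW-UP on `[0, T*)`: else restart past `T*`
  have hH1 : ¬ ∃ A : ℝ≥0, ∀ t ∈ Ico 0 Ts, (∫⁻ x, ‖v t x‖ₑ ^ 2) +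
      (∫⁻ x, ENNReal.ofReal (frobeniusNormSq (fderiv ℝ (v t) x))) ≤ A := by
    intro hA
    obtain ⟨T', hTsT', u', p', hcl', hB', h0', -⟩ :=
      exists_forced_Icc_extension_of_H1_bound hν hTs hfs hfd hv (fun T' hT' => hvB T' hT'.2) hA
    exact habove T' hTsT'.le ⟨hTs.trans hTsT', u', p', hcl', h0'.trans hv0, hB'⟩
  refine ⟨Ts, hTs, v, q, hv, hv0, hvB, hH1, fun hA3 => hH1 (exists_H1_bound_of_H3_bound hA3),
    fun T hTsT w r hw hw0 hwB => ?_⟩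
  -- NO class solution on a closed slab `[0, T]`, `T ≥ T*`
  exact habove T hTsT ⟨hTs.trans_le hTsT, w, r, hw, hw0, hwB⟩

/-- **Global form of the forced alternative**: for `ν > 0`, a Clay-class force and a smooth
divergence-free `H^∞` datum, EITHER there is a classical solution of the forced system on
`[0, ∞) × ℝ³` from `u₀` with all `L²` Sobolev norms bounded on every `[0, T]` (pressure normalised by
`p(t, 0) = 0`), OR there is a classical solution on a maximal half-open slab `[0, T*) × ℝ³`,
`0 < T* < ∞`, in the class on compact sub-slabs, whose `H¹` size and squared `H³` size are unbounded
there and beyond whose end no closed slab carries a class solution from `u₀`. The first branch is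
assembled from the closed slabs by `IsClassicalNSSolutionOn.exists_Ici_of_forall_Icc_of_unique` with
the forced uniqueness theorem `IsClassicalNSSolutionOn.velocity_eq_of_hasBoundedSobolevNormsOn`.
[cite: LemarieRieusset2016, Thm. 7.2 (p. 125) with Thm. 7.3] [cite: Tao2011, Thm. 5.4 (ii)+(iv), Cor. 11.1] -/
theorem exists_global_forced_sobolevClass_or_blowup (hν : 0 < ν) (hfs : IsSmoothOnHalfSpace f)
    (hfd : HasRapidSpaceTimeDecay f) (hu₀ : ContDiff ℝ ∞ u₀) (hdiv : VectorCalculus.IsDivFree u₀)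
    (hH : ∀ n : ℕ, ∫⁻ x, ‖iteratedFDeriv ℝ n u₀ x‖ₑ ^ 2 < ⊤) :
    (∃ (u : ℝ → EuclideanSpace ℝ (Fin 3) → EuclideanSpace ℝ (Fin 3))
        (p : ℝ → EuclideanSpace ℝ (Fin 3) → ℝ),
        IsClassicalNSSolutionOn (Ici 0) ν f u p ∧ u 0 = u₀ ∧
          (∀ T : ℝ, HasBoundedSobolevNormsOn (Icc 0 T) u) ∧ ∀ t, p t 0 = 0) ∨
    ∃ Ts : ℝ, 0 < Ts ∧
      ∃ (u : ℝ → EuclideanSpace ℝ (Fin 3) → EuclideanSpace ℝ (Fin 3))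
        (p : ℝ → EuclideanSpace ℝ (Fin 3) → ℝ),
        IsClassicalNSSolutionOn (Ico 0 Ts) ν f u p ∧ u 0 = u₀ ∧
        (∀ T'' < Ts, HasBoundedSobolevNormsOn (Icc 0 T'') u) ∧
        (¬ ∃ A : ℝ≥0, ∀ t ∈ Ico 0 Ts, (∫⁻ x, ‖u t x‖ₑ ^ 2) +
          (∫⁻ x, ENNReal.ofReal (frobeniusNormSq (fderiv ℝ (u t) x))) ≤ A) ∧
        (¬ ∃ A : ℝ≥0, ∀ t ∈ Ico 0 Ts,
          (∑ n ∈ Finset.range 4, ∫⁻ x, ‖iteratedFDeriv ℝ n (u t) x‖ₑ ^ 2) ≤ (A : ℝ≥0∞)) ∧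
        ∀ T : ℝ, Ts ≤ T →
          ∀ (w : ℝ → EuclideanSpace ℝ (Fin 3) → EuclideanSpace ℝ (Fin 3))
            (q : ℝ → EuclideanSpace ℝ (Fin 3) → ℝ),
            IsClassicalNSSolutionOn (Icc 0 T) ν f w q → w 0 = u₀ →
              ¬ HasBoundedSobolevNormsOn (Icc 0 T) w := by
  rcases forced_sobolevClass_dichotomy hν hfs hfd hu₀ hdiv hH with hall | hblow
  · left
    -- the class `Q T U P`: classical on `[0, T]` from `u₀` with all Sobolev norms bounded
    obtain ⟨u, p, hu, hu0, hp0, hQ⟩ := IsClassicalNSSolutionOn.exists_Ici_of_forall_Icc_of_unique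
      (ν := ν) (f := f) (u₀ := u₀)
      (fun T U P => IsClassicalNSSolutionOn (Icc 0 T) ν f U P ∧ U 0 = u₀ ∧
        HasBoundedSobolevNormsOn (Icc 0 T) U)
      (fun T U P h => ⟨h.1, h.2.1⟩) hall
      (by
        rintro T₁ T₂ U₁ P₁ U₂ P₂ ⟨h₁, h₁0, hB₁⟩ ⟨h₂, h₂0, hB₂⟩ t ht htT₂
        rcases ht.1.eq_or_lt with h0 | htpos
        · rw [← h0, h₁0, h₂0]
        · have hm : 0 < min T₁ T₂ := lt_min (htpos.trans_le ht.2) (htpos.trans_le htT₂)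
          exact (h₁.mono (Icc_subset_Icc_right (min_le_left _ _)) (uniqueDiffOn_Icc hm))
            |>.velocity_eq_of_hasBoundedSobolevNormsOn
            (h₂.mono (Icc_subset_Icc_right (min_le_right _ _)) (uniqueDiffOn_Icc hm)) hν.le hm
            (hB₁.mono (Icc_subset_Icc_right (min_le_left _ _)))
            (hB₂.mono (Icc_subset_Icc_right (min_le_right _ _))) (h₁0.trans h₂0.symm)
            t ⟨ht.1, le_min ht.2 htT₂⟩)
    refine ⟨u, p, hu, hu0, fun T => ?_, hp0⟩
    -- class bounds on `[0, T]`: inherited from the member of horizon `T' ≥ max T 1`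
    obtain ⟨T', U, P, hTT', ⟨-, -, hBU⟩, huU, -⟩ := hQ (max T 1) (lt_max_of_lt_right one_pos)
    intro n
    obtain ⟨C, hC⟩ := hBU n
    refine ⟨C, fun t ht => ?_⟩
    have ht' : t ∈ Icc 0 (max T 1) := ⟨ht.1, ht.2.trans (le_max_left _ _)⟩
    rw [huU t ht']
    exact hC t ⟨ht.1, ht'.2.trans hTT'⟩
  · exact Or.inr hblow

end Literature.Analysis.FluidPDE

end
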